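import Mathlib
import Literature.MathematicalPhysics.QuantumFieldTheory.Balaban1983to89.B9Thm311Lattice

/-! # `Balaban1983to89.B9Eq322Dirichlet` — B9 p. 394, the DIRICHLET paragraph between (3.24) and (3.25): N(Q′) vanishes
off Ω₁, the compression Ω₀ΔΩ₀ by the characteristic function of Ω₀, its locality in U↾Ω₀, and "this permits us to
express R in terms of operators with some boundary conditions outside Ω₁" — kernel-checked

CITATION HEADER.  Paper sub-cell `b2b-balaban-b09` (gen 6, journal claim SHARPEN T06.1 p.394 Dirichlet paragraph: Ω₀ΔΩ₀
compression, N(Q′) vanishes on Ω₁ᶜ, locality in U↾Ω₀, R unchanged pass 18 ∕ C-B9-39-DIRICHLET-BC, cell pub-balaban) on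
T. Balaban, *Propagators for lattice gauge theories in a background field*, Commun. Math. Phys. 99 (1985) 389–434
[`Balaban1985BackgroundPropagators`] (= B9), p. 394 [PDF 6] (render `b2b-balaban-ref1/pages/1985-cmp99-background-
propagators/…-p006-x2.png`, re-read as image in this pass).

WHAT IS PRINTED (verbatim, p. 394).  *"The operator Δ^η_U↾Ω₀ is the covariant Laplace operator with Dirichlet boundary
conditions on Ω₀ᶜ. Let us elaborate this point a little bit more. By the definition of space N(Q′) the functions λ in
(3.22) vanish on Ω₁ᶜ. This permits us to express R in terms of operators with some boundary conditions outside Ω₁. We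
will use only Dirichlet boundary conditions. Let us introduce a domain Ω₀ such that Ω₁ ⊂ Ω₀ and Ω₀ is a union of big
blocks of the lattice T₁, e.g. we may take Ω₀ = {a union of big blocks in T₁, with distances to Ω₁ ≦ RM}, or we may
add to Ω₁ a thinner layer of the big blocks surrounding Ω₁. For such Ω₀ we consider the operator Δ′_a with Dirichlet
boundary conditions on ∂Ω₀, i.e. the operator Δ′_a↾Ω₀ = Ω₀Δ′_aΩ₀. In the last expression Ω₀ denotes a characteristic
function of Ω₀, Its inverse is denoted by G′, or G′(U). The operators with the boundary conditions have a very
important property. They depend on the configuration U restricted to Ω₀."*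

WHAT THIS FILE PROVES (finite lattice carriers E = ⊕_x V of pass 12; [folklore] linear algebra).
1. §1 ABSTRACT (pass 9's `Data`): if two Laplacians Δ, Δ′ AGREE ON N(Q′) then Δ′N(Q′) = ΔN(Q′) (`lapKer_congr`), the
   kernel property transfers (`ker_congr`), and ANY (3.25)-`Data` for (Δ′, Q′, Q′\*, A′) gives the SAME operator R as any
   `Data` for (Δ, Q′, Q′\*, A) (`R325_congr` — an orthogonal projection is determined by its range); `Data` for Δ′ exist
   as soon as Δ′ is symmetric and ≥ 0 (`exists_data_congr`).  This is the content of "This permits us to express R in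
   terms of operators with some boundary conditions outside Ω₁".
2. §2 "Ω₀ denotes a characteristic function of Ω₀": `chi Ω` = multiplication by 1_Ω (pass 12's `AL`), the compression
   `comp Ω Δ` = ΩΔΩ (`comp_symm`, `comp_nonneg`), and `comp_eq_of_supp`: ΩΔΩ f = Δf whenever f is supported in Ω₁ ⊆ Ω₀
   and Δ maps such f to functions supported in Ω₀.
3. §3 LOCALITY of the covariant Laplacian (3.23): if every bond meeting Ω₁ lies in Ω₀ (the "layer"), Δ^η_U maps
   functions supported in Ω₁ to functions supported in Ω₀ (`lapL_supp`); and "They depend on the configuration U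
   restricted to Ω₀": Ω₀Δ^η_UΩ₀ = Ω₀Δ^η_{U′}Ω₀ whenever U, U′ agree on the bonds inside Ω₀, for ISOMETRIC transports
   (`comp_lapL_local`; the straddling bonds contribute the U-free terms c_b‖f(b∩Ω₀)‖²).
4. §4 "By the definition of space N(Q′) the functions λ vanish on Ω₁ᶜ": at every SINGLETON block B(y) = {y} (the level
   j = 0 blocks of (3.18)–(3.19): B⁰(y) = {y}, Q′₀ = evaluation) Q′λ = 0 forces λ(y) = 0 (`apply_eq_zero_of_singleton`,
   `vanish_of_level0`).
5. §5 ASSEMBLY `dirichlet_325`: on a block system whose complement of Ω₁ is level 0, with a bond layer Ω₁ → Ω₀: the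
   (3.25)-`Data` EXIST for the compressed Laplacian Ω₀Δ^η_UΩ₀ (with Δ′_a positive definite, G′, C positive definite) and
   its operator R EQUALS the uncompressed one = the orthogonal projection onto Δ^η_U N(Q′) ((3.20)–(3.21)).
MODELLING NOTE (DIVERGENCE D-b09.30): print compresses the whole Δ′_a = Δ^η_U + Q′\*aQ′ and inverts on L²(Ω₀); here
Q′\*aQ′ is kept on the full carrier (blocks never straddle ∂Ω₀ in print: "Ω₀ is a union of big blocks", so the two differ
by a direct summand supported off Ω₀, invisible to R).  No estimate asserted.  value = kernel-checked bookkeeping, NOT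
summit progress.  Cell records: GAPS C-B9-39, DIVERGENCE D-b09.30. -/

namespace Literature.MathematicalPhysics.QuantumFieldTheory.Balaban1983to89.B9Eq322Dirichlet

open B9Eq325Proj B9Eq323Ker B9Eq319Onto B9Thm311Lattice B9Thm311Data B5Projector144
open scoped InnerProductSpace

/-! ## §1  Abstract: R depends on Δ only through Δ on N(Q′) -/

section Abstract

variable {E F : Type*} [NormedAddCommGroup E] [InnerProductSpace ℝ E] [NormedAddCommGroup F]
  [InnerProductSpace ℝ F]

/-- Laplacians agreeing on N(Q′) have the same image 𝓡 = ΔN(Q′) of (3.21). [cite: Balaban1985BackgroundPropagators, (3.21) p.394] -/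
theorem lapKer_congr {Δ Δ' : E →ₗ[ℝ] E} {q : E →ₗ[ℝ] F} (hag : ∀ l, q l = 0 → Δ' l = Δ l) :
    lapKer Δ' q = lapKer Δ q := by
  ext ω
  rw [mem_lapKer, mem_lapKer]
  constructor
  · rintro ⟨l, hl, rfl⟩
    exact ⟨l, hl, hag l hl⟩
  · rintro ⟨l, hl, rfl⟩
    exact ⟨l, hl, (hag l hl).symm⟩

/-- The kernel property (⟨λ,Δλ⟩ = 0 ∧ Q′λ = 0 ⇒ λ = 0) transfers to a Laplacian agreeing with Δ on N(Q′). [folklore] -/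
theorem ker_congr {Δ Δ' : E →ₗ[ℝ] E} {q : E →ₗ[ℝ] F} (hag : ∀ l, q l = 0 → Δ' l = Δ l)
    (hker : ∀ x : E, ⟪x, Δ x⟫_ℝ = 0 → q x = 0 → x = 0) : ∀ x : E, ⟪x, Δ' x⟫_ℝ = 0 → q x = 0 → x = 0 :=
  fun x hD hq => hker x (by rw [← hag x hq]; exact hD) hq

/-- **"This permits us to express R in terms of operators with some boundary conditions outside Ω₁"**: two systems of
(3.25)-`Data` whose Laplacians agree on N(Q′) define the SAME operator R. [cite: Balaban1985BackgroundPropagators, (3.22)-(3.25) p.394] -/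
theorem R325_congr {Δ Δ' : E →ₗ[ℝ] E} {q : E →ₗ[ℝ] F} {qs : F →ₗ[ℝ] E} {A A' : F →ₗ[ℝ] F} {g g' : E →ₗ[ℝ] E}
    {c c' : F →ₗ[ℝ] F} (h : Data Δ q qs A g c) (h' : Data Δ' q qs A' g' c') (hag : ∀ l, q l = 0 → Δ' l = Δ l) :
    R325 q qs g' c' = R325 q qs g c :=
  eq_of_symm_idem_fix h'.R325_idem h.R325_idem h'.R325_symm h.R325_symm
    (fun x => by rw [h'.R325_fix_iff_mem, h.R325_fix_iff_mem, lapKer_congr hag])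

variable [FiniteDimensional ℝ E] [FiniteDimensional ℝ F]

/-- (3.25)-`Data` EXIST for a symmetric, non-negative Laplacian Δ′ agreeing with Δ on N(Q′), given the pass-11
ingredients for Δ. [cite: Balaban1985BackgroundPropagators, Thm 3.11 p.416, (3.25) p.394] -/
theorem exists_data_congr {Δ Δ' : E →ₗ[ℝ] E} {q : E →ₗ[ℝ] F} {qs : F →ₗ[ℝ] E} {A : F →ₗ[ℝ] F}
    (hΔ' : ∀ x y : E, ⟪Δ' x, y⟫_ℝ = ⟪x, Δ' y⟫_ℝ) (hΔ'nn : ∀ x : E, 0 ≤ ⟪x, Δ' x⟫_ℝ)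
    (hag : ∀ l, q l = 0 → Δ' l = Δ l) (hadj : ∀ (x : E) (φ : F), ⟪q x, φ⟫_ℝ = ⟪x, qs φ⟫_ℝ)
    (hA : ∀ φ ψ : F, ⟪A φ, ψ⟫_ℝ = ⟪φ, A ψ⟫_ℝ) (hApos : PosDef A)
    (hker : ∀ x : E, ⟪x, Δ x⟫_ℝ = 0 → q x = 0 → x = 0) (hqs : Function.Injective qs) :
    ∃ (g' : E →ₗ[ℝ] E) (c' : F →ₗ[ℝ] F), Data Δ' q qs A g' c' ∧ PosDef (lapA Δ' q qs A) ∧ PosDef g' ∧ PosDef c' ∧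
      (∀ x y : E, ⟪g' x, y⟫_ℝ = ⟪x, g' y⟫_ℝ) ∧ (∀ φ ψ : F, ⟪c' φ, ψ⟫_ℝ = ⟪φ, c' ψ⟫_ℝ) :=
  exists_data_of_ingredients hΔ' hadj hA hΔ'nn hApos (ker_congr hag hker) hqs

end Abstract

/-! ## §2  "Ω₀ denotes a characteristic function of Ω₀": the compression Ω₀ΔΩ₀ -/

section Chi

variable {X V : Type*} [NormedAddCommGroup V] [InnerProductSpace ℝ V] [DecidableEq X]

/-- Multiplication by the characteristic function 1_Ω. [cite: Balaban1985BackgroundPropagators, p.394] -/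
noncomputable def chi (Ω : Finset X) : PiLp 2 (fun _ : X => V) →ₗ[ℝ] PiLp 2 (fun _ : X => V) :=
  AL fun x => if x ∈ Ω then (1 : ℝ) else 0

/-- (1_Ω f)(x) = f(x) on Ω. [folklore] -/
theorem chi_apply_of_mem (Ω : Finset X) (f : PiLp 2 (fun _ : X => V)) {x : X} (hx : x ∈ Ω) : chi Ω f x = f x := by
  rw [chi, AL_apply, if_pos hx, one_smul]

/-- (1_Ω f)(x) = 0 off Ω. [folklore] -/
theorem chi_apply_of_not_mem (Ω : Finset X) (f : PiLp 2 (fun _ : X => V)) {x : X} (hx : x ∉ Ω) :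
    chi Ω f x = 0 := by
  rw [chi, AL_apply, if_neg hx, zero_smul]

/-- 1_Ω f = f for f supported in Ω. [folklore] -/
theorem chi_eq_self (Ω : Finset X) {f : PiLp 2 (fun _ : X => V)} (hf : ∀ x ∉ Ω, f x = 0) : chi Ω f = f := by
  apply PiLp.ext
  intro x
  by_cases hx : x ∈ Ω
  · exact chi_apply_of_mem Ω f hx
  · rw [chi_apply_of_not_mem Ω f hx, hf x hx]

/-- **ΩΔΩ** — "the operator Δ↾Ω = ΩΔΩ … Ω denotes a characteristic function of Ω".
[cite: Balaban1985BackgroundPropagators, p.394] -/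
noncomputable def comp (Ω : Finset X) (Δ : PiLp 2 (fun _ : X => V) →ₗ[ℝ] PiLp 2 (fun _ : X => V)) :
    PiLp 2 (fun _ : X => V) →ₗ[ℝ] PiLp 2 (fun _ : X => V) :=
  chi Ω ∘ₗ Δ ∘ₗ chi Ω

/-- Unfolding of `comp`. [folklore] -/
theorem comp_apply (Ω : Finset X) (Δ : PiLp 2 (fun _ : X => V) →ₗ[ℝ] PiLp 2 (fun _ : X => V))
    (f : PiLp 2 (fun _ : X => V)) : comp Ω Δ f = chi Ω (Δ (chi Ω f)) := rfl

/-- Ω₀ΔΩ₀ f = Δf for f supported in Ω₁ ⊆ Ω₀ when Δ maps such f into functions supported in Ω₀. [folklore] -/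
theorem comp_eq_of_supp {Ω₁ Ω₀ : Finset X} (h10 : Ω₁ ⊆ Ω₀)
    {Δ : PiLp 2 (fun _ : X => V) →ₗ[ℝ] PiLp 2 (fun _ : X => V)}
    (hloc : ∀ f : PiLp 2 (fun _ : X => V), (∀ x ∉ Ω₁, f x = 0) → ∀ x ∉ Ω₀, Δ f x = 0)
    {f : PiLp 2 (fun _ : X => V)} (hf : ∀ x ∉ Ω₁, f x = 0) : comp Ω₀ Δ f = Δ f := by
  have hf0 : ∀ x ∉ Ω₀, f x = 0 := fun x hx => hf x fun h1 => hx (h10 h1)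
  rw [comp_apply, chi_eq_self Ω₀ hf0, chi_eq_self Ω₀ (hloc f hf)]

variable [Fintype X]

/-- 1_Ω is symmetric. [folklore] -/
theorem chi_symm (Ω : Finset X) (f g : PiLp 2 (fun _ : X => V)) : ⟪chi Ω f, g⟫_ℝ = ⟪f, chi Ω g⟫_ℝ :=
  AL_symm _ f g

/-- ΩΔΩ is symmetric when Δ is. [folklore] -/
theorem comp_symm (Ω : Finset X) {Δ : PiLp 2 (fun _ : X => V) →ₗ[ℝ] PiLp 2 (fun _ : X => V)}
    (hΔ : ∀ f g, ⟪Δ f, g⟫_ℝ = ⟪f, Δ g⟫_ℝ) (f g : PiLp 2 (fun _ : X => V)) :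
    ⟪comp Ω Δ f, g⟫_ℝ = ⟪f, comp Ω Δ g⟫_ℝ := by
  rw [comp_apply, comp_apply, chi_symm, hΔ, chi_symm]

/-- ⟨f, ΩΔΩ f⟩ = ⟨1_Ω f, Δ 1_Ω f⟩. [folklore] -/
theorem inner_comp_self (Ω : Finset X) (Δ : PiLp 2 (fun _ : X => V) →ₗ[ℝ] PiLp 2 (fun _ : X => V))
    (f : PiLp 2 (fun _ : X => V)) : ⟪f, comp Ω Δ f⟫_ℝ = ⟪chi Ω f, Δ (chi Ω f)⟫_ℝ := by
  rw [comp_apply, ← chi_symm]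

/-- ΩΔΩ ≥ 0 when Δ ≥ 0. [folklore] -/
theorem comp_nonneg (Ω : Finset X) {Δ : PiLp 2 (fun _ : X => V) →ₗ[ℝ] PiLp 2 (fun _ : X => V)}
    (hΔnn : ∀ f, 0 ≤ ⟪f, Δ f⟫_ℝ) (f : PiLp 2 (fun _ : X => V)) : 0 ≤ ⟪f, comp Ω Δ f⟫_ℝ := by
  rw [inner_comp_self]
  exact hΔnn _

end Chi

/-! ## §3  Locality of the covariant Laplacian (3.23) -/

section Local

variable {X V : Type*} [NormedAddCommGroup V] [InnerProductSpace ℝ V] [DecidableEq X] [Fintype X]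
  [FiniteDimensional ℝ V]

/-- If every bond meeting Ω₁ lies inside Ω₀, then Δ^η_U maps functions supported in Ω₁ to functions supported in Ω₀
(1_{Ω₀}Δf = Δf). [cite: Balaban1985BackgroundPropagators, (3.23) p.394] -/
theorem chi_lapL_of_supp (τ : X → X → V →ₗ[ℝ] V) (bonds : Finset (X × X)) (cb : X × X → ℝ) {Ω₁ Ω₀ : Finset X}
    (hlayer : ∀ b ∈ bonds, (b.1 ∈ Ω₁ ∨ b.2 ∈ Ω₁) → b.1 ∈ Ω₀ ∧ b.2 ∈ Ω₀) {f : PiLp 2 (fun _ : X => V)}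
    (hf : ∀ x ∉ Ω₁, f x = 0) : chi Ω₀ (lapL τ bonds cb f) = lapL τ bonds cb f := by
  refine ext_inner_left ℝ fun g => ?_
  rw [← chi_symm, inner_lapL_right, inner_lapL_right, PiLp.inner_apply, PiLp.inner_apply]
  refine Finset.sum_congr rfl fun b _ => ?_
  simp only [DL_apply, covD_apply]
  by_cases h1 : b.1.1 ∈ Ω₁ ∨ b.1.2 ∈ Ω₁
  · obtain ⟨hx, hx'⟩ := hlayer b.1 b.2 h1
    have e1 : (chi Ω₀ g) b.1.1 = g b.1.1 := chi_apply_of_mem Ω₀ g hx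
    have e2 : (chi Ω₀ g) b.1.2 = g b.1.2 := chi_apply_of_mem Ω₀ g hx'
    have e1' : WithLp.ofLp (chi Ω₀ g) b.1.1 = WithLp.ofLp g b.1.1 := e1
    have e2' : WithLp.ofLp (chi Ω₀ g) b.1.2 = WithLp.ofLp g b.1.2 := e2
    rw [e1', e2']
  · push Not at h1
    have f1 : WithLp.ofLp f b.1.1 = 0 := hf _ h1.1
    have f2 : WithLp.ofLp f b.1.2 = 0 := hf _ h1.2
    rw [f1, f2, map_zero, sub_zero, smul_zero, inner_zero_right, inner_zero_right]

/-- Pointwise form: (Δ^η_U f)(x) = 0 off Ω₀ for f supported in Ω₁. [cite: Balaban1985BackgroundPropagators, (3.23) p.394] -/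
theorem lapL_supp (τ : X → X → V →ₗ[ℝ] V) (bonds : Finset (X × X)) (cb : X × X → ℝ) {Ω₁ Ω₀ : Finset X}
    (hlayer : ∀ b ∈ bonds, (b.1 ∈ Ω₁ ∨ b.2 ∈ Ω₁) → b.1 ∈ Ω₀ ∧ b.2 ∈ Ω₀) (f : PiLp 2 (fun _ : X => V))
    (hf : ∀ x ∉ Ω₁, f x = 0) : ∀ x ∉ Ω₀, lapL τ bonds cb f x = 0 := by
  intro x hx
  rw [← chi_lapL_of_supp τ bonds cb hlayer hf]
  exact chi_apply_of_not_mem Ω₀ _ hx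

/-- Hence Ω₀Δ^η_UΩ₀ = Δ^η_U on functions supported in Ω₁. [cite: Balaban1985BackgroundPropagators, p.394] -/
theorem comp_lapL_eq_of_supp (τ : X → X → V →ₗ[ℝ] V) (bonds : Finset (X × X)) (cb : X × X → ℝ)
    {Ω₁ Ω₀ : Finset X} (h10 : Ω₁ ⊆ Ω₀) (hlayer : ∀ b ∈ bonds, (b.1 ∈ Ω₁ ∨ b.2 ∈ Ω₁) → b.1 ∈ Ω₀ ∧ b.2 ∈ Ω₀)
    {f : PiLp 2 (fun _ : X => V)} (hf : ∀ x ∉ Ω₁, f x = 0) :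
    comp Ω₀ (lapL τ bonds cb) f = lapL τ bonds cb f :=
  comp_eq_of_supp h10 (fun f hf => lapL_supp τ bonds cb hlayer f hf) hf

/-- **"They depend on the configuration U restricted to Ω₀"**: for ISOMETRIC transports, Ω₀Δ^η_UΩ₀ = Ω₀Δ^η_{U′}Ω₀
whenever U and U′ agree on the bonds with both ends in Ω₀ (a straddling bond b contributes the U-free term
c_b‖f(b ∩ Ω₀)‖²). [cite: Balaban1985BackgroundPropagators, p.394] -/
theorem comp_lapL_local (τ τ' : X → X → V →ₗ[ℝ] V) (hτ : ∀ x x' (v v' : V), ⟪τ x x' v, τ x x' v'⟫_ℝ = ⟪v, v'⟫_ℝ)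
    (hτ' : ∀ x x' (v v' : V), ⟪τ' x x' v, τ' x x' v'⟫_ℝ = ⟪v, v'⟫_ℝ) (bonds : Finset (X × X)) (cb : X × X → ℝ)
    (Ω₀ : Finset X) (hag : ∀ b ∈ bonds, b.1 ∈ Ω₀ → b.2 ∈ Ω₀ → τ b.1 b.2 = τ' b.1 b.2) :
    comp Ω₀ (lapL τ bonds cb) = comp Ω₀ (lapL τ' bonds cb) := by
  refine LinearMap.ext fun f => ext_inner_left ℝ fun g => ?_
  rw [comp_apply, comp_apply, ← chi_symm, ← chi_symm, inner_lapL_right, inner_lapL_right, PiLp.inner_apply,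
    PiLp.inner_apply]
  refine Finset.sum_congr rfl fun b _ => ?_
  simp only [DL_apply, covD_apply, real_inner_smul_left, real_inner_smul_right]
  congr 2
  by_cases hx : b.1.1 ∈ Ω₀
  · by_cases hx' : b.1.2 ∈ Ω₀
    · rw [hag b.1 b.2 hx hx']
    · have g2 : WithLp.ofLp (chi Ω₀ g) b.1.2 = 0 := chi_apply_of_not_mem Ω₀ g hx'
      have f2 : WithLp.ofLp (chi Ω₀ f) b.1.2 = 0 := chi_apply_of_not_mem Ω₀ f hx'
      rw [g2, f2, map_zero, map_zero]
  · have g1 : WithLp.ofLp (chi Ω₀ g) b.1.1 = 0 := chi_apply_of_not_mem Ω₀ g hx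
    have f1 : WithLp.ofLp (chi Ω₀ f) b.1.1 = 0 := chi_apply_of_not_mem Ω₀ f hx
    simp only [g1, f1, sub_zero, hτ, hτ']

end Local

/-! ## §4  "By the definition of space N(Q′) the functions λ in (3.22) vanish on Ω₁ᶜ" -/

section Vanish

variable {X Y V : Type*} [NormedAddCommGroup V] [InnerProductSpace ℝ V]

/-- At a singleton block B(y) = {y} (a block of order 0: B⁰(y) = {y}, Q′₀ = evaluation in (3.19)), Q′λ = 0 forces
λ(y) = 0. [cite: Balaban1985BackgroundPropagators, (3.19) p.393, p.394] -/
theorem apply_eq_zero_of_singleton (τ : X → X → V →ₗ[ℝ] V) {bonds : Finset (X × X)} {w : Y → X → ℝ}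
    {B : Y → Finset X} {Γ : Y → X → List X} {y : Y → X} (hS : IsBlockSystem bonds w B Γ y) {c : Y}
    (hc : B c = {y c}) {f : PiLp 2 (fun _ : X => V)} (hf : qL τ w B Γ y f = 0) : f (y c) = 0 := by
  have h := congrArg (fun φ : PiLp 2 (fun _ : Y => V) => φ c) hf
  simp only [PiLp.zero_apply] at h
  rw [qL_apply, avgQ, hc, Finset.sum_singleton, hS.centre_path c, pathTr_singleton, LinearMap.id_apply] at h
  exact (smul_eq_zero.mp h).resolve_left (hS.centre_wt c)

/-- Hence if every site off Ω₁ is the centre of a singleton block (Ω₁ᶜ is "level 0"), every λ ∈ N(Q′) vanishes on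
Ω₁ᶜ. [cite: Balaban1985BackgroundPropagators, p.394] -/
theorem vanish_of_level0 (τ : X → X → V →ₗ[ℝ] V) {bonds : Finset (X × X)} {w : Y → X → ℝ} {B : Y → Finset X}
    {Γ : Y → X → List X} {y : Y → X} (hS : IsBlockSystem bonds w B Γ y) {Ω₁ : Finset X}
    (h0 : ∀ x ∉ Ω₁, ∃ c, B c = {y c} ∧ y c = x) {f : PiLp 2 (fun _ : X => V)} (hf : qL τ w B Γ y f = 0) :
    ∀ x ∉ Ω₁, f x = 0 := by
  intro x hx
  obtain ⟨c, hc, rfl⟩ := h0 x hx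
  exact apply_eq_zero_of_singleton τ hS hc hf

end Vanish

/-! ## §5  Assembly: the Dirichlet-compressed system reproduces R -/

section Assembly

variable {X Y V : Type*} [NormedAddCommGroup V] [InnerProductSpace ℝ V] [DecidableEq X] [Fintype X] [Fintype Y]
  [FiniteDimensional ℝ V]

/-- **The Dirichlet paragraph of p. 394, assembled.**  On a finite lattice block system in which every site off Ω₁ is
a singleton (order-0) block and every bond meeting Ω₁ lies in Ω₀ ⊇ Ω₁: the (3.25)-`Data` EXIST for the compressed
Laplacian Ω₀Δ^η_UΩ₀ (Δ′_a, G′, C positive definite, G′, C symmetric), the operator R they define EQUALS the one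
defined by any `Data` of the uncompressed Δ^η_U, and it is the orthogonal projection onto 𝓡 = Δ^η_U N(Q′).
[cite: Balaban1985BackgroundPropagators, (3.20)-(3.25) p.394, Thm 3.11 p.416] -/
theorem dirichlet_325 (τ : X → X → V →ₗ[ℝ] V) (hinj : ∀ x x' : X, Function.Injective (τ x x'))
    {bonds : Finset (X × X)} (cb : X × X → ℝ) (hcb : ∀ b ∈ bonds, 0 < cb b) {w : Y → X → ℝ} {B : Y → Finset X}
    {Γ : Y → X → List X} {y : Y → X} (hS : IsBlockSystem bonds w B Γ y) (a : Y → ℝ) (ha : ∀ c, 0 < a c)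
    {Ω₁ Ω₀ : Finset X} (h10 : Ω₁ ⊆ Ω₀) (hlayer : ∀ b ∈ bonds, (b.1 ∈ Ω₁ ∨ b.2 ∈ Ω₁) → b.1 ∈ Ω₀ ∧ b.2 ∈ Ω₀)
    (h0 : ∀ x ∉ Ω₁, ∃ c, B c = {y c} ∧ y c = x) :
    ∃ (g' : PiLp 2 (fun _ : X => V) →ₗ[ℝ] PiLp 2 (fun _ : X => V))
      (c' : PiLp 2 (fun _ : Y => V) →ₗ[ℝ] PiLp 2 (fun _ : Y => V)),
      Data (comp Ω₀ (lapL τ bonds cb)) (qL τ w B Γ y) (LinearMap.adjoint (qL τ w B Γ y)) (AL a) g' c' ∧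
        PosDef (lapA (comp Ω₀ (lapL τ bonds cb)) (qL τ w B Γ y) (LinearMap.adjoint (qL τ w B Γ y)) (AL a)) ∧
        PosDef g' ∧ PosDef c' ∧ (∀ f f', ⟪g' f, f'⟫_ℝ = ⟪f, g' f'⟫_ℝ) ∧ (∀ φ ψ, ⟪c' φ, ψ⟫_ℝ = ⟪φ, c' ψ⟫_ℝ) ∧
        (∀ {A : PiLp 2 (fun _ : Y => V) →ₗ[ℝ] PiLp 2 (fun _ : Y => V)}
            {g : PiLp 2 (fun _ : X => V) →ₗ[ℝ] PiLp 2 (fun _ : X => V)}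
            {c : PiLp 2 (fun _ : Y => V) →ₗ[ℝ] PiLp 2 (fun _ : Y => V)},
            Data (lapL τ bonds cb) (qL τ w B Γ y) (LinearMap.adjoint (qL τ w B Γ y)) A g c →
              R325 (qL τ w B Γ y) (LinearMap.adjoint (qL τ w B Γ y)) g' c' =
                R325 (qL τ w B Γ y) (LinearMap.adjoint (qL τ w B Γ y)) g c) ∧
        ∀ f, R325 (qL τ w B Γ y) (LinearMap.adjoint (qL τ w B Γ y)) g' c' f =
          (lapKer (lapL τ bonds cb) (qL τ w B Γ y)).starProjection f := by
  have hag : ∀ l : PiLp 2 (fun _ : X => V), qL τ w B Γ y l = 0 → comp Ω₀ (lapL τ bonds cb) l = lapL τ bonds cb l :=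
    fun l hl => comp_lapL_eq_of_supp τ bonds cb h10 hlayer (vanish_of_level0 τ hS h0 hl)
  obtain ⟨g', c', hd, hpos, hg, hc, hgs, hcs⟩ :=
    exists_data_congr (comp_symm Ω₀ (lapL_symm τ bonds cb)) (comp_nonneg Ω₀ (lapL_nonneg τ bonds cb)) hag
      (qL_adjoint_pair τ w B Γ y) (AL_symm a) (AL_posDef a ha)
      (fun f hD hQ => lapL_qL_kernel τ hinj cb hcb hS f hD hQ) (adjoint_qL_injective τ hS)
  obtain ⟨g, c, hd0, hproj⟩ := proj_325_lattice τ hinj cb hcb hS a ha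
  exact ⟨g', c', hd, hpos, hg, hc, hgs, hcs, fun h => R325_congr h hd hag, fun f => by
    rw [R325_congr hd0 hd hag, hproj f]⟩

end Assembly

end Literature.MathematicalPhysics.QuantumFieldTheory.Balaban1983to89.B9Eq322Dirichlet
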